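import Summits.QuantumFields.BalabanUV.T4Continuum.Support.NE3EnergyRateWSupOfEndpointChart
import HarnessLib

/-!
# T⁴ programme, node NE3 — THE RE-TYPED ROOT T-E_w♯ OVER `sfClass` WITH (P♮)_W AS A CLASS-LEVEL STATEMENT: the END of the local
# half of NE3 whose analytic hypotheses are (i) the endpoint chart of the pair, (ii) the level data, (iii) (P♮)_W UNIFORMLY ON THE
# SMALL-FIELD CLASS at each level — the form row K6 of route H♮ (`NE3SlicePoincareCurved`, K6c-2b) delivers — and nothing else

NE3 (node U1b), row NE3 OWNER `b2b-balaban-t4-ne3-p1` (gen 24); junction design `D-ne3p1-g23-1.md` §5 ∕ `D-ne3p1-g24-1.md` §6; over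
`NE3EnergyRateWSupOfEndpointChart.ne3EnergyRateWSup_sfClass_of_endpointChart` and the class transport `rescale_bavg_mem_sfClass`.

WHY THIS FILE.  The junction ENDs (`NE3EnergyRateWSupOfSlicePoincare`, `NE3EnergyRateWSupOfEndpointChart`) ask, per pair `(U_A, U_B)`, for
`SlicePoincare L (j+1) (cavg L U_B) (T_♮(cavg L U_B)) CP (periodBox (N·L^{j+1}))`.  Row K6's END (`slicePoincare_frameFreeBlockLandauW`,
leaf-02-g6) proves (P♮)_W for EVERY unitary `N·L^{j+1}`-periodic `W` in the small-field ball of radius `x` under displayed numeric level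
conditions — i.e. a CLASS-LEVEL statement.  Since `cavg L U_B ∈ sfClass d L N ε (j+1)` for `U_B` regular at level `j+2` (class transport
`rescale_bavg_mem_sfClass`), the per-pair hypothesis is discharged by the class-level one; this file performs exactly that step, so that the
END's (P♮) hypothesis has the SHAPE row K6 supplies: `∀ j W, W ∈ sfClass d L N ε (j+1) → SlicePoincare L (j+1) W (T_♮(W)) CP (periodBox …)`.

CONTENT ([folklore]; 0 def, 0 sorry): `slicePoincare_mono` (monotone in the constant); `classSlicePoincare_of_levelwise` (level constants
`Cj j ≤ CP` ⟹ uniform `CP`); `sfClass_data`; **`ne3EnergyRateWSup_sfClass_of_classSlicePoincare`**.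

HONEST FRAMING.  Bookkeeping; the numeric level conditions of K6c-2b and the uniformity of its constant in `j` (the K-road letters) are NOT
discharged here — they are what turns K6c-2b into the hypothesis `hP` below; the endpoint chart (route Π: `DecomposedRep` and its suppliers)
and (H∃) remain hypotheses; T-E_w♯, NE3 NOT proved; spine PROVED 0∕9; finite T⁴ rung (B)+1 — NOT infinite volume, NOT mass gap, NOT
`BetaPertH`, NOT Clay.  PLACEMENT: `Summits/QuantumFields/BalabanUV/`.  HONEST DEPENDENCY: continuum YM on T⁴ ⇐ BetaPertH ∧ nine spine
estimates (0/9 proved); BetaPertH ⇐ (D1) ∧ (D4) ∧ CAP+tail; G-an2-4 gates asym, D1 and NE2/3/4.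
-/

set_option autoImplicit false

open scoped BigOperators Matrix.Norms.L2Operator
open NormedSpace Finset

namespace Summit.QuantumFields.BalabanUV.T4Continuum.NE3EnergyRateWSupCurved

open Set
open Literature.MathematicalPhysics.QuantumFieldTheory.Balaban1983to89
open B7Prop1Explicit B7Prop2Explicit
open T4AveragingDeficitWall hiding Site Plane Plaq Bond
open T4AveragingDeficitWallBoundary (IsPeriodicCfg periodBox)
open AveragingDeficitChartCalculus (cavg)
open AveragingDeficitMultiLevelPrep (LevelSmall)
open MinimalActionSandwich (IsMinimiser)
open MinimalActionRate (Regular sfClass rescale_bavg_mem_sfClass)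
open NE3EnergyWeightedShapes (energyNormW)
open NE3EnergyWeightedSupShape (NE3EnergyRateWSup)
open NE3SlicePoincareShape (SlicePoincare)
open NE3FrameFreeSliceW (frameFreeBlockLandauW)
open NE3EnergyRateWSupOfSlicePoincare (cLambda)
open NE3EndpointChart (EndpointChart)
open NE3EnergyRateWSupOfEndpointChart (ne3EnergyRateWSup_sfClass_of_endpointChart)

noncomputable section

variable {d : ℕ} {n : Type*} [Fintype n] [DecidableEq n]

/-- (P♮)_W is monotone in its constant. [folklore] -/
theorem slicePoincare_mono {L k : ℕ} {W : Site d → Fin d → (Matrix n n ℂ)ˣ} {T : Set (Site d → Fin d → Matrix n n ℂ)}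
    {C C' : ℝ} {F : Finset (Site d)} (h : SlicePoincare L k W T C F) (hCC' : C ≤ C') : SlicePoincare L k W T C' F := by
  intro Y hY
  exact (h Y hY).trans (mul_le_mul_of_nonneg_right hCC' (NE3EnergyHessContTwoTerm.curlSq_nonneg W Y F))

/-- **UNIFORMISATION**: class-level (P♮)_W at every level with level-dependent constants `Cj j ≤ CP` gives the uniform class-level
(P♮)_W with constant `CP` (the form `hP` below).  This is where row K6's END (`slicePoincare_frameFreeBlockLandauW` at `x_j = ε∕(L^{j+1})²`,
constant `C_j(x_j)`) and the K-road letter bounds (`C_j(x_j) ≤ CP`) meet. [folklore] -/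
theorem classSlicePoincare_of_levelwise {L N : ℕ} {ε CP : ℝ} {Cj : ℕ → ℝ} (hCj : ∀ j : ℕ, Cj j ≤ CP)
    (hK6 : ∀ j : ℕ, ∀ W : Site d → Fin d → (Matrix n n ℂ)ˣ, W ∈ sfClass d L N ε (j + 1) →
      SlicePoincare L (j + 1) W (frameFreeBlockLandauW L N (j + 1) W) (Cj j) (periodBox (N * L ^ (j + 1)))) :
    ∀ j : ℕ, ∀ W : Site d → Fin d → (Matrix n n ℂ)ˣ, W ∈ sfClass d L N ε (j + 1) →
      SlicePoincare L (j + 1) W (frameFreeBlockLandauW L N (j + 1) W) CP (periodBox (N * L ^ (j + 1))) :=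
  fun j W hW => slicePoincare_mono (hK6 j W hW) (hCj j)

/-- Membership in the small-field class, unfolded: unitary, `N·L^k`-periodic, plaquettes within `ε∕(L^k)²` — the three data row K6's END
asks of its background (with `tower L N k = N·L^k`, `NE3EnergyRateWSupOfSlicePoincare.tower_eq_mul_pow`). [folklore] -/
theorem sfClass_data {L N : ℕ} {ε : ℝ} {k : ℕ} {W : Site d → Fin d → (Matrix n n ℂ)ˣ} (hW : W ∈ sfClass d L N ε k) :
    IsUnitaryCfg W ∧ IsPeriodicCfg W ((N * L ^ k : ℕ) : ℤ) ∧ SmallField W (ε / ((L : ℝ) ^ k) ^ 2) := hW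

/-- **T-E_w♯ OVER `sfClass` FROM ENDPOINT CHARTS AND CLASS-LEVEL (P♮)_W** (`d ≥ 2`, `L, N ≥ 1`, `0 ≤ b < ε`, `g > 0`, the two numeric
conditions of the class transport `rescale_bavg_mem_sfClass`, row Y9's multi-level smallness).  If (P♮)_W holds with ONE constant `CP`
for every member of `sfClass d L N ε (j+1)` at every `j` (`hP` — the shape of row K6's END), and at every level, datum and pair of
minimisers there is an ENDPOINT chart with uniform `(θ, κ, θ₀, q)` and level data `(α, a)` — THEN
`NE3EnergyRateWSup d (sfClass d L N ε) L N b g ((1+θ₀)·(4∕cΛ)·C′_{R♯5d}) ((√Λ−1)∕(24√d)) dom`. [folklore] -/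
theorem ne3EnergyRateWSup_sfClass_of_classSlicePoincare [Nonempty n] (hd : 2 ≤ d) {L N : ℕ} [NeZero L] [NeZero N] (hL : 1 ≤ L)
    (hN : 1 ≤ N) {ε b g : ℝ} (hb : 0 ≤ b) (hbε : b < ε) (hg : 0 < g)
    (hbs : 512 * (d + 1) * (d + 4) * (L : ℝ) ^ 2 * b ≤ 1) (hbε' : b + 226 * (8 * (d + 1) * (d + 4)) ^ 2 * b ^ 2 ≤ ε)
    (hsmall : ∀ j : ℕ, LevelSmall d L (j + 1) (ε / ((L : ℝ) ^ (j + 2)) ^ 2))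
    {dom : Set (Site d → Fin d → (Matrix n n ℂ)ˣ)} {CP Λ θ κ θ₀ q : ℝ}
    (hCP : 0 ≤ CP) (hreg₁ : CP * (Real.sqrt Λ - 1) ^ 2 ≤ 1 / 4) (hθ₀ : 0 ≤ θ₀)
    (hbudget : 2 * Λ * θ + Λ * θ ^ 2 + κ + 2 * q ≤ cLambda n CP Λ / 2)
    (hP : ∀ j : ℕ, ∀ W : Site d → Fin d → (Matrix n n ℂ)ˣ, W ∈ sfClass d L N ε (j + 1) →
      SlicePoincare L (j + 1) W (frameFreeBlockLandauW L N (j + 1) W) CP (periodBox (N * L ^ (j + 1))))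
    (hchart : ∀ j : ℕ, ∀ V ∈ dom, ∀ UA UB : Site d → Fin d → (Matrix n n ℂ)ˣ,
      IsMinimiser d (sfClass d L N ε) L N (j + 1) V UA → IsMinimiser d (sfClass d L N ε) L N (j + 2) V UB →
        Regular d L N b g (j + 2) UB →
        ∃ (u : Site d → (Matrix n n ℂ)ˣ) (Γ Ψ Ψ' : ℝ → Site d → Fin d → Matrix n n ℂ) (Xref : Site d → Fin d → Matrix n n ℂ)
          (α a : ℝ), 0 ≤ α ∧ 0 ≤ a ∧
          EndpointChart (sfClass d L N ε) L N (j + 1) V UA UB u Γ Ψ Ψ' Xref (frameFreeBlockLandauW L N (j + 1) (cavg L UB))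
            (fun Y => energyNormW L (j + 1) (cavg L UB) Y (periodBox (N * L ^ (j + 1)))) θ κ θ₀ q a ∧
          (∀ t (x : Site d) (μ : Fin d), ‖Γ t x μ‖ ≤ α) ∧
          (1 + 24 * Real.sqrt d * (Real.exp α - 1) * (L : ℝ) ^ (j + 1)) ^ 2 + 48 * d * a * ((L : ℝ) ^ (j + 1)) ^ 2 ≤ Λ ∧
          112 * (d : ℝ) * a * CP * ((L : ℝ) ^ (j + 1)) ^ 2 ≤ 1 / (2 * (Fintype.card n : ℝ))) :
    NE3EnergyRateWSup d (sfClass d L N ε) L N b g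
      ((1 + θ₀) * (4 / cLambda n CP Λ)
        * (Real.sqrt ((L : ℝ) ^ (d - 2))
            + (Real.sqrt ((L : ℝ) ^ (d - 2)) * Real.sqrt (8 * Fintype.card (T4AveragingDeficitWall.Plane d))
                * (128 * (d * (L : ℝ) ^ 2))
              + 2 * (2048 * ((d : ℝ) + 4) ^ 2 * (L : ℝ) ^ 2 * Real.sqrt (d * (L : ℝ) ^ d))) * b
            + b ^ 2 * (2 * (L : ℝ) ^ (d - 1) + 2 * (8 * d * (L : ℝ) ^ d)) * Real.sqrt (d / (g * (L : ℝ) ^ (d + 2)))))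
      ((Real.sqrt Λ - 1) / (24 * Real.sqrt d)) dom :=
  ne3EnergyRateWSup_sfClass_of_endpointChart hd hL hN hb hbε hg hsmall hCP hreg₁ hθ₀ hbudget
    fun j V hV UA UB hA hB hreg => by
      obtain ⟨u, Γ, Ψ, Ψ', Xref, α, a, hα, ha, hpath, hΓα, hΛw, hreg₂⟩ := hchart j V hV UA UB hA hB hreg
      exact ⟨u, Γ, Ψ, Ψ', Xref, α, a, hα, ha, hpath, hΓα, hΛw, hreg₂,
        hP j (cavg L UB) (rescale_bavg_mem_sfClass hL hb hbs hbε' hreg)⟩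

end

end Summit.QuantumFields.BalabanUV.T4Continuum.NE3EnergyRateWSupCurved
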